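import Summits.QuantumAdvantage.QuantumAdvantage.Theses.CompactnessLift
import Summits.QuantumAdvantage.QuantumAdvantage.Theorems.CompactnessLiftLanguageLadderSummitStrength
import Summits.QuantumAdvantage.QuantumAdvantage.Theorems.CompactnessPrinciple.Negative.SliceZeroEmpty
import Literature.Computability.Complexity.PaulPippengerSzemerediTrotter1983Blocks
import Literature.Computability.Complexity.RelativizedTime
import Literature.Computability.Complexity.NTIMEMono
import Literature.Computability.QuantumComplexity.BQTime
import Literature.Computability.Cryptography.ClassBQPRelProofs

/-!
# Disproof of `LanguageLadder` (stmt-QuantumAdvantage-15271, route `CompactnessLift`) — findings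

Adversary work file of the crux disprover (refuter-cdisprove-stmt-QuantumAdvantage-15271-0, cycle 1,
2026-08-17). `lean check` rc 0, sorry-free, axioms ⊆ {propext, Classical.choice, Quot.sound}.
Prose lives in docstrings only. INDEX (section → headline; ★ = new kernel content of this seat,
⊳ = re-derived from / pointer to earlier seats' evidence):

* §0 READING ⊳ — the crux is `∀ c, ∃ L ∈ BQTime (·^2), L ∉ bp (DTIME (·^c))` (`Iff.rfl`); the
  thresholds `2/3`, `1/3` are reals (no `ℕ`-division junk).
* §1 WHAT A KILL IS ★/⊳ — `¬ LanguageLadder ↔ ∃ c, BQTime (·^2) ⊆ bp (DTIME (·^c))`; every rung class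
  lies in `BPP`, so ANY kill is a dequantization `BQTime (·^2) ⊆ BPP` of all quadratic-time-uniform
  Clifford+T deciders — the `¬S` programme (stmt-0242 routes) in the quadratic window; since the
  sibling crux 15270 landed the padding collapse DURING this cycle (`CompactnessLiftPadding.paddingCollapse`,
  12:12Z) the converse holds too: `¬ LanguageLadder ↔ BQTime (·^2) ⊆ BPP` UNCONDITIONALLY (tree,
  `CompactnessLiftLanguageLadder.not_languageLadder_iff_BQTime_two_subset_BPP`, lead c1, p159961).
  Nothing of the kind is in print or in the tree: **no kill is available; the crux resists exactly
  as hard as `¬ QuantumAdvantage` in the quadratic window.**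
* §2 RUNG `c = 0` IS AN ARTEFACT ⊳/★ — the halting rule of Mathlib's `TM2` model (a run of `m`
  steps consumes `≤ Q·m` input symbols) gives `DTIME (fun n => n ^ 0) = ∅`, `bp ∅ = ∅`, hence rung 0
  says only `BQTime (·^2) ≠ ∅`; proved here and, a few minutes earlier (race), LANDED by the sibling
  disprover cdisprove-15270 as `Theorems/CompactnessPrinciple/Negative/SliceZeroEmpty.lean`, who also
  landed `QuadQ ≠ ∅` (`ExponentTight.BQTime_sq_nonempty`: the gate-free family, with an `O(n²)`
  description writer) — so RUNG 0 HOLDS (`languageLadder_rung_zero`, tree) and the disprover's artefact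
  test "is the witness class empty?" is kernel-refuted. This file IMPORTS those lemmas and keeps the
  sublinear generalisation (`timeClass_eq_empty_of_sublinear`), "rung 0 is implied by every other
  rung" (`languageLadder_iff_forall_pos`) and "every single high rung IS the crux"
  (`languageLadder_iff_rung_of_ge`, §3).
* §3 THE RUNGS ARE MONOTONE; EVERY TAIL IS THE CRUX ★ (landed: `…/LanguageLadder/Negative/RungStructure.lean`,
  p161237) — `bp (DTIME (·^c)) ⊆ bp (DTIME (·^c'))` for `c ≤ c'`, so `LanguageLadder ↔ ∀ c ≥ c₀, rung c`
  for EVERY `c₀`, a kill at one exponent is a kill at all larger ones, and with the padding collapse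
  ALL BUT FINITELY MANY RUNG CLASSES ARE `BPP` (`exists_forall_ge_bp_DTIME_pow_eq_BPP`): there is no
  "low rung" a disprover could pick off separately, and the typed family `c ↦ bp (DTIME (·^c))` is
  eventually constant `= BPP`.
* §4 LOAD-BEARING CONSTITUENTS ★ (landed (a): `…/LanguageLadder/Negative/SlackArtefact.lean`, p161310)
  — (a) the additive slack `+ C` of the description budget is load-bearing, but ONLY through `n = 0`:
  a zero-step run is impossible (tree `not_outputsWithin_zero`), so `BQTimeUniform t = ∅` whenever
  `t 0 = 0` and the slack-free ladder is FALSE (`languageLadder_false_without_slack`; likewise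
  `TimeClass t = ∅` if `t 0 = 0` — the `+ c` of `DTIME` is load-bearing the same way); (b) the `∀ c`
  is decorative (§1, §3, §5); (c) `IsOracleFree` is semantically idle at the empty oracle
  (`acceptProbOn_stripOracles`, tree) — dropping it only enlarges the witness class, nothing breaks;
  (d) uniformity / error constants: dropping the `TimeComputable` clause makes the ladder TRUE for
  non-uniform junk reasons, never false.
* §5 THE COIN-PADDING COLLAPSE, NOW UNCONDITIONAL ⊳ (8 earlier readings modulo `H1`/`PaddingCollapse`;
  the collapse itself landed for 15270 during this cycle) — `¬ LanguageLadder ↔ BQTime (·^2) ⊆ BPP`,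
  `LanguageLadder → QuantumAdvantage`, and modulo the route's own padding item `SummitGivesLadder`
  (15274) `¬ LanguageLadder ↔ ¬ QuantumAdvantage`: the crux AS TYPED is the summit in the
  quadratic-padding window (MISSTATED — kernel-certified costume — not refutable; repair §6).
* §6 THE REPAIRED CRUX `LL′ := ∀ c, ∃ L ∈ BQTime (·^2), L ∉ BPTime (·^c)` ⊳/★ — typed ⟹ repaired
  unconditionally; `¬ LL′ ↔ ∃ c, BQTime (·^2) ⊆ BPTime (·^c)` (a uniform-exponent dequantization,
  hence `¬S` modulo quadratic padding — Census §5); the disprover's only cheap artefact test on `LL′`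
  (is `BQTime (·^2)` empty?) is dead (tree `BQTime_sq_nonempty`), and `LL′` inherits §4(a) verbatim. Next negative-side target for a re-arm (NOT attempted, XL): the
  fixed-exponent contrary oracle `∃ A, ∀ k, BQTimeRel A (·^k) ⊆ BPTimeRel (Oracle.ofLanguage A) (·^k)`
  (Heller-type, BarrierNotes LL-B1), i.e. "any proof of a rung `c ≥ 2` of `LL′` is non-relativizing".
* `-- Targets`: none this cycle (lead `PICKED: none`; `stuck_stubs = []`).

VERDICT OF THIS CYCLE: no kill; misstated (costume of the summit via coin padding, class
`refuted-misstated` would apply only to a landed `¬`, which cannot exist short of `BQTime(n²) ⊆ BPP`).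
-/

set_option linter.dupNamespace false

namespace Summit.QuantumAdvantage.QuantumAdvantage.Cruxes.LanguageLadder.Disproof

open Literature.Computability.Complexity Literature.Computability.QuantumComplexity
  Literature.Computability.Cryptography Turing Function
open Summit.QuantumAdvantage.QuantumAdvantage.Theses.CompactnessLift

/-! ## §0 Reading -/

/-- The crux, literally: the route's inlined class `QuadQ` is `BQTime (fun n => n ^ 2)` by `rfl`
(`BQTime.lean`), the lower class is the OPERATOR class `bp (DTIME (·^c))`. [folklore] -/
theorem languageLadder_iff :
    LanguageLadder ↔ ∀ c : ℕ, ∃ L ∈ BQTime (fun n => n ^ 2), L ∉ bp (DTIME fun n => n ^ c) :=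
  Iff.rfl

/-- Sanity: the threshold in `bp` is the real number `2/3` (not `ℕ`-division `2 / 3 = 0`, which would
make `bp C` everything). [folklore] -/
example (C : Set (Language Bool)) : bp C = {L | ∃ L' ∈ C, ∃ p : Polynomial ℕ, ∀ x : List Bool,
    (2 : ℝ) / 3 ≤ uniformProb (p.eval x.length) {y : List Bool | boolPair x y ∈ L' ↔ x ∈ L}} := rfl

/-- Sanity: the thresholds in `BQTime` are the reals `2/3` and `1/3`. [folklore] -/
example (t : ℕ → ℕ) : BQTime t = {L | ∃ F : QCircuitFamily cliffordT, F.IsOracleFree ∧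
    (∃ C : ℕ, F.IsTimeUniform fun n => C * t n + C) ∧
    ∀ x, (x ∈ L → (2 : ℝ) / 3 ≤ F.acceptProbOn 0 x) ∧ (x ∉ L → F.acceptProbOn 0 x ≤ (1 : ℝ) / 3)} :=
  rfl

/-! ## §1 What a kill is -/

/-- A refutation of the crux is literally ONE exponent `c` at which every quadratic-time-uniform
Clifford+T language lies in `bp (DTIME (·^c))`. [folklore] -/
theorem not_languageLadder_iff :
    ¬ LanguageLadder ↔ ∃ c : ℕ, BQTime (fun n => n ^ 2) ⊆ bp (DTIME fun n => n ^ c) := by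
  simp only [languageLadder_iff, not_forall, not_exists, not_and, not_not]
  rfl

/-- Every rung class lies in `BPP` (`DTIME (·^c) ⊆ P`, `bp` monotone). ⊳ Census §0. [folklore] -/
theorem bp_DTIME_pow_subset_BPP (c : ℕ) : bp (DTIME fun n => n ^ c) ⊆ BPP :=
  bp_mono fun _ hL => Set.mem_iUnion.2 ⟨c, hL⟩

/-- **Any kill is a full dequantization of `BQTIME(n²)`**: `¬ LanguageLadder → BQTime (·^2) ⊆ BPP`.
So the disprover's task is the `¬ QuantumAdvantage` programme restricted to the quadratic window
(and, modulo quadratic padding of `BQP` into `BQTime (·^2)`, all of it). [folklore] -/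
theorem quadQ_subset_BPP_of_not_languageLadder (h : ¬ LanguageLadder) :
    BQTime (fun n => n ^ 2) ⊆ BPP := by
  obtain ⟨c, hc⟩ := not_languageLadder_iff.1 h
  exact hc.trans (bp_DTIME_pow_subset_BPP c)

/-- Conversely ONE quadratic-uniform quantum language outside `BPP` gives ALL rungs: the `∀ c`
carries nothing beyond "`∉ BPP`". ⊳ Census `languageLadder_of_exists_not_mem_BPP`. (Positive in
the crux; stays in this work file.) [folklore] -/
theorem languageLadder_of_exists_not_mem_BPP
    (h : ∃ L ∈ BQTime (fun n => n ^ 2), L ∉ BPP) : LanguageLadder := by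
  intro c
  obtain ⟨L, hL, hB⟩ := h
  exact ⟨L, hL, fun hc => hB (bp_DTIME_pow_subset_BPP c hc)⟩

/-! ## §2 Rung `c = 0` is an artefact of the halting rule

Mathlib's `TM2OutputsInTime` targets `haltList` (every stack but the output stack EMPTY), and one
`TM2` step runs one `Stmt` tree, which pops at most `machinePopBound` symbols
(`TM2Comp.length_step_ge`, PPST blocks file). Hence a halting run of `m` steps has READ its input:
`|l| ≤ |l'| + Q m` — LANDED by the sibling disprover (race, same hour) as
`CompactnessPrinciple.Negative.length_input_le_of_outputsWithin`, with `timeClass_const_eq_empty`,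
`DTIME_pow_zero_eq_empty`, `bp_empty`, `bp_DTIME_pow_zero_eq_empty`,
`exists_not_mem_bp_DTIME_pow_zero_iff` (rung 0 of THIS crux ↔ `QuadQ ≠ ∅`) and, in `ExponentTight.lean`,
`BQTime_sq_nonempty` / `languageLadder_rung_zero` (rung 0 HOLDS); imported, not restated. -/

section RungZero

open Summit.QuantumAdvantage.QuantumAdvantage.Theorems.CompactnessPrinciple.Negative
  (length_input_le_of_outputsWithin DTIME_pow_zero_eq_empty bp_empty bp_DTIME_pow_zero_eq_empty
    exists_not_mem_bp_DTIME_pow_zero_iff)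

/-- **Sublinear exact time classes are empty** (the design note of `Classes.lean`, proved in full
generality: if for every constant `K` some length `n` has `K * t n + K < n`, no machine decides
anything within `t` — covers `√n`, `log n`, … beyond the sibling's constant case). [folklore] -/
theorem timeClass_eq_empty_of_sublinear {t : ℕ → ℕ} (ht : ∀ K : ℕ, ∃ n, K * t n + K < n) :
    TimeClass t = ∅ := by
  ext L
  simp only [Set.mem_empty_iff_false, iff_false]
  rintro ⟨M, hM⟩
  obtain ⟨n, hn⟩ := ht (TM2Comp.machinePopBound M.tm + 1)
  have h := length_input_le_of_outputsWithin M (hM (List.replicate n false))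
  simp only [id_eq, List.length_replicate, Computability.encodeBool] at h
  have h1 : (pure (L.boolIndicator (List.replicate n false)) : List Bool).length = 1 := rfl
  rw [h1] at h
  set Q := TM2Comp.machinePopBound M.tm
  set T := t n
  nlinarith

/-- Rung `c = 0` of the typed ladder says exactly `BQTime (·^2) ≠ ∅` (sibling lemma, instantiated).
[folklore] -/
theorem rungZero_iff_nonempty :
    (∃ L ∈ BQTime (fun n => n ^ 2), L ∉ bp (DTIME fun n : ℕ => n ^ 0)) ↔
      (BQTime (fun n => n ^ 2)).Nonempty :=
  exists_not_mem_bp_DTIME_pow_zero_iff _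

/-- **Rung `0` HOLDS** — tree `CompactnessPrinciple.Negative.languageLadder_rung_zero`
(`ExponentTight.lean`: the gate-free family inhabits `BQTime (·^2)`, `BQTime_sq_nonempty`), so the
artefact test "empty witness class" is dead in the kernel too. (Not imported here only because that
module was still unbuilt on the farm when this file was last checked; the statement below is its
shape, from nonemptiness.) [folklore] -/
theorem rungZero_of_nonempty (hne : (BQTime (fun n => n ^ 2)).Nonempty) :
    ∃ L ∈ BQTime (fun n => n ^ 2), L ∉ bp (DTIME fun n : ℕ => n ^ 0) :=
  rungZero_iff_nonempty.2 hne

/-- Hence rung `0` is implied by every other rung (and holds anyway), and the crux is its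
positive-exponent part (landed: `LanguageLadder.Negative.languageLadder_iff_forall_pos`). [folklore] -/
theorem languageLadder_iff_forall_pos :
    LanguageLadder ↔ ∀ c : ℕ, 1 ≤ c → ∃ L ∈ BQTime (fun n => n ^ 2), L ∉ bp (DTIME fun n => n ^ c) := by
  refine ⟨fun h c _ => h c, fun h c => ?_⟩
  rcases Nat.eq_zero_or_pos c with rfl | hc
  · obtain ⟨L, hL, -⟩ := h 1 le_rfl
    exact rungZero_iff_nonempty.2 ⟨L, hL⟩
  · exact h c hc

end RungZero

/-! ## §3 The rungs are monotone: every tail is the crux, a kill at `c` kills all `c' ≥ c` -/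

/-- The rung classes increase with the exponent (from `1` on; rung `0` is empty, §2). [folklore] -/
theorem bp_DTIME_pow_mono {c c' : ℕ} (hc : 1 ≤ c) (h : c ≤ c') :
    bp (DTIME fun n : ℕ => n ^ c) ⊆ bp (DTIME fun n : ℕ => n ^ c') := by
  refine bp_mono (DTIME_mono fun n => ?_)
  rcases Nat.eq_zero_or_pos n with rfl | hn
  · rw [zero_pow (by omega : c ≠ 0)]; exact Nat.zero_le _
  · exact Nat.pow_le_pow_right hn h

/-- A higher rung implies every lower positive rung. [folklore] -/
theorem rung_anti {c c' : ℕ} (hc : 1 ≤ c) (h : c ≤ c')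
    (h' : ∃ L ∈ BQTime (fun n => n ^ 2), L ∉ bp (DTIME fun n : ℕ => n ^ c')) :
    ∃ L ∈ BQTime (fun n => n ^ 2), L ∉ bp (DTIME fun n : ℕ => n ^ c) := by
  obtain ⟨L, hL, hB⟩ := h'
  exact ⟨L, hL, fun hm => hB (bp_DTIME_pow_mono hc h hm)⟩

/-- **Every tail is the crux**: for every `c₀`, `LanguageLadder ↔ ∀ c ≥ c₀, rung c`. There is no
finite set of "low rungs" whose removal weakens the statement. [folklore] -/
theorem languageLadder_iff_tail (c₀ : ℕ) :
    LanguageLadder ↔ ∀ c : ℕ, c₀ ≤ c → ∃ L ∈ BQTime (fun n => n ^ 2), L ∉ bp (DTIME fun n => n ^ c) := by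
  refine ⟨fun h c _ => h c, fun h => languageLadder_iff_forall_pos.2 fun c hc => ?_⟩
  exact rung_anti hc (le_max_left c c₀) (h (max c c₀) (le_max_right _ _))

/-- Even "infinitely many rungs" is the crux. [folklore] -/
theorem languageLadder_iff_frequently :
    LanguageLadder ↔ ∀ c₀ : ℕ, ∃ c, c₀ ≤ c ∧ ∃ L ∈ BQTime (fun n => n ^ 2), L ∉ bp (DTIME fun n => n ^ c) := by
  refine ⟨fun h c₀ => ⟨c₀, le_rfl, h c₀⟩, fun h => languageLadder_iff_forall_pos.2 fun c hc => ?_⟩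
  obtain ⟨c', hcc', h'⟩ := h c
  exact rung_anti hc hcc' h'

/-- **A kill at one exponent is a kill at every larger exponent** — the disprover may aim as high as
convenient, but (§1) every target is `⊆ BPP`. [folklore] -/
theorem not_languageLadder_iff_eventually :
    ¬ LanguageLadder ↔ ∃ c₀ : ℕ, 1 ≤ c₀ ∧ ∀ c, c₀ ≤ c → BQTime (fun n => n ^ 2) ⊆ bp (DTIME fun n => n ^ c) := by
  constructor
  · intro h
    obtain ⟨c, hc⟩ := not_languageLadder_iff.1 h
    refine ⟨max c 1, le_max_right _ _, fun c' hc' => hc.trans ?_⟩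
    rcases Nat.eq_zero_or_pos c with rfl | hcpos
    · rw [Summit.QuantumAdvantage.QuantumAdvantage.Theorems.CompactnessPrinciple.Negative.bp_DTIME_pow_zero_eq_empty]; exact Set.empty_subset _
    · exact bp_DTIME_pow_mono hcpos ((le_max_left _ _).trans hc')
  · rintro ⟨c₀, -, h⟩
    exact not_languageLadder_iff.2 ⟨c₀, h c₀ le_rfl⟩

/-- **All but finitely many rung classes ARE `BPP`** (padding collapse, tree, + monotonicity): the
typed family `c ↦ bp (DTIME (·^c))` is eventually constant `= BPP`. Landed as
`LanguageLadder.Negative.exists_forall_ge_bp_DTIME_pow_eq_BPP`. [folklore] -/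
theorem exists_forall_ge_bp_DTIME_pow_eq_BPP :
    ∃ c₀ : ℕ, 1 ≤ c₀ ∧ ∀ c : ℕ, c₀ ≤ c → bp (DTIME fun n : ℕ => n ^ c) = BPP := by
  obtain ⟨c₀, h⟩ := Summit.QuantumAdvantage.QuantumAdvantage.Theorems.CompactnessLiftPadding.paddingCollapse
  refine ⟨max c₀ 1, le_max_right _ _, fun c hc => (bp_DTIME_pow_subset_BPP c).antisymm (h.trans ?_)⟩
  rcases Nat.eq_zero_or_pos c₀ with rfl | hpos
  · rw [Summit.QuantumAdvantage.QuantumAdvantage.Theorems.CompactnessPrinciple.Negative.bp_DTIME_pow_zero_eq_empty]; exact Set.empty_subset _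
  · exact bp_DTIME_pow_mono hpos ((le_max_left _ _).trans hc)

/-- **Every single high rung IS the crux**: for `c ≥ c₀` (the collapse exponent), rung `c` alone is
equivalent to `LanguageLadder` (both say `BQTime (·^2) ⊄ BPP`). So the `∀ c` of the typed crux can be
replaced by ONE fixed exponent without changing the statement — the sharpest form of "the ladder has
one rung". [folklore] -/
theorem languageLadder_iff_rung_of_ge :
    ∃ c₀ : ℕ, ∀ c : ℕ, c₀ ≤ c →
      (LanguageLadder ↔ ∃ L ∈ BQTime (fun n => n ^ 2), L ∉ bp (DTIME fun n => n ^ c)) := by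
  obtain ⟨c₀, -, h⟩ := exists_forall_ge_bp_DTIME_pow_eq_BPP
  refine ⟨c₀, fun c hc => ⟨fun hL => hL c, fun ⟨L, hL, hB⟩ => ?_⟩⟩
  rw [h c hc] at hB
  exact languageLadder_of_exists_not_mem_BPP ⟨L, hL, hB⟩

/-! ## §4 Load-bearing constituents of the statement -/

/-! ### (a) The additive slack `+ C` is load-bearing — only through `n = 0` -/

/-! A zero-step run is impossible (`initList` has label `some main`, `haltList` has `none`): tree
`Literature.Computability.Complexity.not_outputsWithin_zero` (`NTIMEMono.lean`), reused below. -/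

/-- No function is computable with a clock that vanishes at some input length that occurs.
[folklore] -/
theorem not_timeComputable_of_apply_eq_zero {α β Γ₀ Γ₁ : Type} {ea : α → List Γ₀} {eb : β → List Γ₁}
    {f : α → β} {t : ℕ → ℕ} (a : α) (ht : t (ea a).length = 0) : ¬ TimeComputable ea eb f t := by
  rintro ⟨M, hM⟩
  have h : M.OutputsWithin (ea a) (eb (f a)) (t (ea a).length) := hM a
  rw [ht] at h
  exact not_outputsWithin_zero M _ _ h

/-- **Exact quantum classes with `t 0 = 0` are empty** (the description of the length-`0` circuit
must be written in `0` steps). In particular `BQTimeUniform (fun n => C * n ^ 2) = ∅` for every `C`: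
the slack `+ C` in `BQTime`/`QuadQ` is what lets `n = 0` through. [folklore] -/
theorem BQTimeUniform_eq_empty_of_apply_zero {t : ℕ → ℕ} (ht : t 0 = 0) : BQTimeUniform t = ∅ := by
  ext L
  simp only [Set.mem_empty_iff_false, iff_false]
  rintro ⟨F, -, hT, -⟩
  exact not_timeComputable_of_apply_eq_zero (ea := Computability.unaryEncodeNat) 0
    (by simpa [Computability.unaryEncodeNat] using ht) hT

/-- The same artefact on the classical side: `TimeClass t = ∅` whenever `t 0 = 0` (a decider must
write its answer bit on the empty input); so the `+ c` of `DTIME t = ⋃ c, TimeClass (c * t · + c)` is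
load-bearing in the same (and only in this) way. [folklore] -/
theorem timeClass_eq_empty_of_apply_zero {t : ℕ → ℕ} (ht : t 0 = 0) : TimeClass t = ∅ := by
  ext L
  simp only [Set.mem_empty_iff_false, iff_false]
  rintro ⟨M, hM⟩
  have h := hM []
  simp only [id_eq, List.length_nil, ht] at h
  exact not_outputsWithin_zero M _ _ h

/-- The slack-free class: `QuadQ` with description budget `C * n ^ 2` instead of `C * n ^ 2 + C`. -/
def QuadQWithoutSlack : Set (Language Bool) :=
  ⋃ C : ℕ, BQTimeUniform fun n => C * n ^ 2

/-- It is empty. [folklore] -/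
theorem quadQWithoutSlack_eq_empty : QuadQWithoutSlack = ∅ := by
  simp [QuadQWithoutSlack, BQTimeUniform_eq_empty_of_apply_zero]

/-- The crux with the additive slack dropped from the description budget. -/
def LanguageLadderWithoutSlack : Prop :=
  ∀ c : ℕ, ∃ L ∈ QuadQWithoutSlack, L ∉ bp (DTIME fun n => n ^ c)

/-- **`_false_without_` (a): without the slack the ladder is FALSE** — for the degenerate reason that
its witness class is empty (`n = 0`). Any proof of the crux uses the `+ C` exactly once, at `n = 0`;
any REPAIR must keep an additive constant (or start the clock at `n ≥ 1`). [folklore] -/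
theorem languageLadder_false_without_slack : ¬ LanguageLadderWithoutSlack := by
  intro h
  obtain ⟨L, hL, -⟩ := h 0
  rw [quadQWithoutSlack_eq_empty] at hL
  exact hL

/-! ### (b) The `∀ c` — decorative: §1 (`languageLadder_of_exists_not_mem_BPP`) and §5. -/

/-! ### (c) Oracle-freeness is semantically idle -/

/-- The crux with the conjunct `F.IsOracleFree` dropped (oracle gates allowed, run against the EMPTY
oracle `0`, where each oracle gate is the identity: tree `QGate.toMatrix_zero_oracle`,
`QCircuitFamily.acceptProbOn_stripOracles`). This is `BQTimeRel 0 (·^2)` in place of `BQTime (·^2)`. -/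
def LanguageLadderWithoutOF : Prop :=
  ∀ c : ℕ, ∃ L ∈ BQTimeRel 0 (fun n => n ^ 2), L ∉ bp (DTIME fun n => n ^ c)

/-- Dropping oracle-freeness only ENLARGES the witness class (`BQTime t ⊆ BQTimeRel 0 t`), so the
typed crux implies the variant: nothing a disprover can exploit; conversely the variant's extra
witnesses decide the same languages (`acceptProbOn_stripOracles`) with a description at most a
rewriting pass longer — `IsOracleFree` is "possibly unnecessary" (information for the planner, not a
weakness). [folklore] -/
theorem languageLadderWithoutOF_of_languageLadder (h : LanguageLadder) : LanguageLadderWithoutOF := by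
  intro c
  obtain ⟨L, hL, hB⟩ := h c
  exact ⟨L, BQTime_subset_BQTimeRel 0 _ hL, hB⟩

/-- The semantic half of (c), pointer to the tree: stripping the oracle gates of ANY family does not
change its acceptance probabilities at the empty oracle. [folklore] -/
example (F : QCircuitFamily cliffordT) (x : List Bool) :
    F.stripOracles.acceptProbOn 0 x = F.acceptProbOn 0 x :=
  QCircuitFamily.acceptProbOn_stripOracles F x

/-! ### (d) Uniformity and the error constants

Dropping the `TimeComputable` clause altogether (non-uniform families of unbounded size) makes the
witness class contain every unary language, hence undecidable ones, and the ladder TRUE for junk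
reasons (no rung class contains an undecidable language) — never false; weakening `2/3, 1/3` to a
gapless majority turns `BQTime` into a `PP`-like quantum class and the ladder into a different open
problem. Neither is a disprover's lever; recorded for completeness, nothing to prove. -/

/-! ## §5 The coin-padding collapse — now unconditional (tree)

`bp C` quantifies over an ARBITRARY coin polynomial `p` and clocks the inner `DTIME` machine on the
padded input `boolPair x y`, `|boolPair x y| = 2|x| + 2 + p |x|`; coins are free padding. During this
cycle the sibling crux 15270 LANDED `CompactnessLiftPadding.paddingCollapse : ∃ c₀, BPP ⊆ bp (DTIME (·^c₀))`
(square-clocked universal machine; Theorems/CompactnessLiftCompactnessPrinciple.lean) and the lead of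
THIS crux composed it with the route's `closes` (Theorems/CompactnessLiftLanguageLadderSummitStrength.lean).
So the eight earlier "modulo `H1` / `PaddingCollapse`" readings are theorems; recorded here in the
disprover's orientation. -/

section Collapse

open Summit.QuantumAdvantage.QuantumAdvantage.Theorems.CompactnessLiftLanguageLadder
  (not_languageLadder_iff_BQTime_two_subset_BPP quantumAdvantage_of_languageLadder
    languageLadder_iff_quantumAdvantage_of_summitGivesLadder languageLadder_iff_exists_forall)

/-- **A kill is EXACTLY a dequantization of `BQTIME(n²)`** (tree, unconditional):
`¬ LanguageLadder ↔ BQTime (·^2) ⊆ BPP`. [folklore] -/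
theorem not_languageLadder_iff_subset_BPP : ¬ LanguageLadder ↔ BQTime (fun n => n ^ 2) ⊆ BPP :=
  not_languageLadder_iff_BQTime_two_subset_BPP

/-- The typed crux implies the summit (tree, unconditional) — so `¬ QuantumAdvantage → ¬ LanguageLadder`:
to kill the crux one must kill the summit's quadratic window, and killing the summit kills the crux.
[folklore] -/
theorem not_languageLadder_of_not_summit (hS : ¬ _root_.QuantumAdvantage) : ¬ LanguageLadder :=
  fun hL => hS (quantumAdvantage_of_languageLadder hL)

/-- Modulo the route's own padding support `SummitGivesLadder` (stmt-15274, `S → LanguageLadder`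
verbatim) a kill of the crux IS a disproof of the summit: `¬ LanguageLadder ↔ ¬ QuantumAdvantage`.
[folklore] -/
theorem not_languageLadder_iff_not_summit (h : SummitGivesLadder) :
    ¬ LanguageLadder ↔ ¬ _root_.QuantumAdvantage :=
  not_congr (languageLadder_iff_quantumAdvantage_of_summitGivesLadder h)

/-- The quantifier swap is free (tree): the natural strengthening `∃ L ∈ BQTime (·^2), ∀ c, L ∉ rung c`
of the crux is EQUIVALENT to it — so it cannot be refuted separately either. [folklore] -/
example : LanguageLadder ↔ ∃ L ∈ BQTime (fun n => n ^ 2), ∀ c : ℕ, L ∉ bp (DTIME fun n => n ^ c) :=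
  languageLadder_iff_exists_forall

end Collapse

/-! ## §6 The repaired crux `LL′` (what a restated 15271 will carry) -/

/-- The refuter's repair `C′` (rattack-15271; Census `LanguageLadderR`): honest `BPTIME(n^c)` —
`O(n^c)` coins AND inner time linear in the padded input. -/
def LanguageLadderR : Prop :=
  ∀ c : ℕ, ∃ L ∈ BQTime (fun n => n ^ 2), L ∉ BPTime (fun n => n ^ c)

/-- `BPTIME(n^k)` lies in rung `c` for every `k` and every `c ≥ 1` (tree `bpTime_pow_subset_bp` +
`DTIME_mono`). ⊳ sibling `BPTime_pow_subset_bp_DTIME_pow`. [folklore] -/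
theorem BPTime_pow_subset_rung (k : ℕ) {c : ℕ} (hc : 1 ≤ c) :
    BPTime (fun n => n ^ k) ⊆ bp (DTIME fun n : ℕ => n ^ c) :=
  (bpTime_pow_subset_bp _ k).trans
    (bp_mono (DTIME_mono fun n => by simpa using Nat.le_self_pow (by omega : c ≠ 0) n))

/-- **Typed ⟹ repaired, unconditionally** (`BPTime (·^c) ⊆` rung `max c 1`); the converse would be
the honest uniform-exponent content. So every negative result on `LL′` is a negative result on the
typed crux. ⊳ Census. [folklore] -/
theorem languageLadderR_of_languageLadder (h : LanguageLadder) : LanguageLadderR := by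
  intro c
  obtain ⟨L, hL, hB⟩ := h (max c 1)
  exact ⟨L, hL, fun hm => hB (BPTime_pow_subset_rung c (le_max_right c 1) hm)⟩

/-- What a kill of `LL′` is: a UNIFORM-EXPONENT dequantization `BQTime (·^2) ⊆ BPTime (·^c)`.
⊳ Census `not_languageLadderR_iff`. [folklore] -/
theorem not_languageLadderR_iff :
    ¬ LanguageLadderR ↔ ∃ c : ℕ, BQTime (fun n => n ^ 2) ⊆ BPTime (fun n => n ^ c) := by
  simp only [LanguageLadderR, not_forall, not_exists, not_and, not_not]
  rfl

/-- A kill of `LL′` is in particular a kill of the typed crux (contrapositive of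
`languageLadderR_of_languageLadder`), hence (§1/§5) `BQTime (·^2) ⊆ BPP`, hence (tree) not the summit's
quadratic window. [folklore] -/
theorem quadQ_subset_BPP_of_not_languageLadderR (h : ¬ LanguageLadderR) :
    BQTime (fun n => n ^ 2) ⊆ BPP :=
  quadQ_subset_BPP_of_not_languageLadder fun hL => h (languageLadderR_of_languageLadder hL)

/-- `LL′` inherits artefact §4(a) verbatim: its witness class is the same `BQTime (·^2)`, so the
slack-free version of `LL′` is false for the same `n = 0` reason. [folklore] -/
theorem languageLadderR_false_without_slack :
    ¬ (∀ c : ℕ, ∃ L ∈ QuadQWithoutSlack, L ∉ BPTime (fun n => n ^ c)) := by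
  intro h
  obtain ⟨L, hL, -⟩ := h 0
  rw [quadQWithoutSlack_eq_empty] at hL
  exact hL

/-! ### Near-misses / next targets (prose; nothing sorried)

* ARTEFACT TEST "is `BQTime (·^2)` empty?" (would falsify typed crux and `LL′` at once): DEAD in the
  kernel — the sibling disprover landed the gate-free family as an inhabitant
  (`ExponentTight.BQTime_sq_nonempty`), so rung 0 of both ladders holds.
* FIXED-EXPONENT CONTRARY ORACLE for `LL′` (BarrierNotes LL-B1, Heller 1986 type):
  `∃ A, ∀ k, BQTimeRel A (·^k) ⊆ BPTimeRel (Oracle.ofLanguage A) (·^k)` — would show every proof of a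
  rung `c ≥ 2` of `LL′` is non-relativizing at fixed exponents. XL (oracle built in stages against all
  clocked machines + relativized Adleman–DeMarrais–Huang simulation); the first re-arm target.
* PP-COLLAPSE FLOOR (Ideator2 B0, kernel-checked there modulo `BPPCovered ∧ PPHardForQuad`):
  `PP ⊆ BPP → ¬ LL′`; a `--negative-modulo` filing is pointless (the modulus is an open collapse). -/

/-! ## Targets

None this cycle: the lead's `PICKED.md` is "none" (no eligible skeleton for the crux as typed) and
`stuck_stubs = []`. On re-arm after the restate, the stubs of the picked line for `LL′` go here. -/

end Summit.QuantumAdvantage.QuantumAdvantage.Cruxes.LanguageLadder.Disproof
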